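import Literature.MathematicalPhysics.QuantumFieldTheory.Balaban1983to89.B9Thm311PerMemberCubeZdTouching
import Literature.MathematicalPhysics.QuantumFieldTheory.Balaban1983to89.B9SupplySockB9P3ZdAtHermInAk
import Literature.MathematicalPhysics.QuantumFieldTheory.Balaban1983to89.B8Prop6OfThm4

/-!
# `Balaban1983to89.B9Thm311InvAtHIWitnessCubeZd` — [Balaban1985BackgroundPropagators] (3.27) p. 395 ∕ Thm 3.11 p. 416 ∕ [Balaban1985RegularSpaces] (1.58) p. 86:
# THE JUNCTION'S (3.27) BINDER INHABITED AT `m ≥ 1` — `InvAtHI L (withGopZdH (opsAllZd τ L (cubeLamBP …) ops₀)) aI M i m` HOLDS at every cube member,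
# every truncation `m ≤ k`, for the GENUINE `G_𝔤(U₀) = (□₀Δ_a(U₀)□₀)⁻¹` of the genuine four-letter `Δ_a`, with a member-dependent `aI > 0`; and the β
# collar socket at the member for that record with the (3.27), Δ′, Landau and averaging binders ALL DISCHARGED (displayed: the dictionary, Prop. 6, Thm 3.3)

statement-level skeleton of published theorems with citation tags; proofs where landed; nothing here is a claim about the
Yang–Mills mass gap

`[Balaban1985BackgroundPropagators]` ("B9", CMP **99** (1985) 389–434; journal page = PDF page + 388): (3.27) p. 395 («G(U) = (Ω₀Δ_aΩ₀)⁻¹ … Dirichlet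
boundary conditions on Ω₀ᶜ»), Thm 3.11 p. 416 («the operators … Δ_a, G are positive definite»), (3.26) p. 395, (3.69) p. 404, (3.16) p. 393, (3.20)–(3.25)
p. 394, Thm 3.3 p. 399, (3.47) p. 398.  `[Balaban1985RegularSpaces]` ("B8", CMP **99** (1985) 75–102): (1.7) p. 77, (1.33) p. 82, (1.58)–(1.59) p. 86
(«Theorem 3.3 of [4] implies the bounds (1.59)»), Prop. 6, (1.131) p. 99 (the cube member).  `[Balaban1984PropagatorsII]` (2.3) p. 224 (print's class of
averaging bonds, here `cubeLamBP`).

CITATION HEADER ∕ WHY THIS FILE (cell `pub-ymgap`, HUMAN RULING D-0062; seat `pub-ymgap-dag-n06-b` (g20), binder∕letter owner of the junction J-N06→N05).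
The ten At-binders of this lineage's member suppliers (`B9SupplySockB9P3ZdAt*`) are HYPOTHESES on an operator record; referee ref-A's standing A6 question
(WATCH-JSAT, READ-4∕21, g5) is whether they are jointly INHABITED by the genuine operators of [B9] Sect. A.  At `m = 0` this lineage witnessed them with
model operators (`…UnivWitness`, `…Beta`, `…Gamma`); at `m ≥ 1` the (3.27) slot needs the genuine `G(U₀)` = Theorem 3.11 (g12: «N06 object layer, XL»).
With the per-member Theorem 3.11 now in the datum's currency (`B9Thm311PerMemberCubeZdTouching`, g20) and the binder re-keyed to that currency
(`B9SupplySockB9P3ZdAtHermInAk.InvAtHI`, g20), THIS FILE closes the slot PER MEMBER: §2 ★★★ `invAtHI_withGopZdH_opsAllZd_cube` — at every cube member,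
every `m ≤ k`, `∃ aI > 0` with `InvAtHI L (withGopZdH (opsAllZd τ L (cubeLamBP …) ops₀)) aI M i m` (dag-n06-w4 g2∕this seat g18: `withGopZdH` puts
`G_𝔤 := (□₀Δ_a(U₀)□₀)⁻¹` into the record's `Gop` slot; `opsAllZd` = the genuine `Δ′` (dag-n06-w2), `D R(U₀) 𝟙 D*` (dag-n06-w4), `Q*aQ` (this seat g17∕g19)
on the base record `ops₀`).  §3 then runs the β collar-socket member supplier `sockB9P3D4γIHI_at` at that record with `hinv` (this file), `hcurv`
(`curvAtInAk_opsAllZd`, dag-n06-w2∕w4), `hlan` (`landauAt_opsAllZd`, dag-n06-w4), `havg` (`avgAtγ_opsAllZd_cubeLamBP`, g19 EDITION P₀), `hsee`, `Margin2`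
DISCHARGED BY NAME: ★★★ `sockB9P3D4γ_withGopZdH_opsAllZd_cube` — the four-line collar socket `SockB9P3D4β` at the member for the genuine record, GIVEN
ONLY the dictionary `DictAt`, Prop. 6 `Prop6At` and Theorem 3.3's (3.42)∕(3.47) block for `G_𝔤(U₀)` at the frame (N06's analytic content proper).

WHAT IS PROVED (kernel, 0 sorry, 0 def; no `instance`, no `notation`).
* §1 `curvAtInAk_withGopZdH_iff` ∕ `landauAt_withGopZdH_iff` ∕ `avgAtγ_withGopZdH_iff` (the co-letter binders do not read `Gop`: `Iff.rfl`).
* §2 ★★★ `invAtHI_withGopZdH_opsAllZd_cube`; `exists_datum_inAk` (A6: for every `α₀ > 0` the flat background is a unitary datum of `𝔄_m({□_j}, α₀)` —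
  the binder's hypothesis set is met); ★★ `invAtHI_withGopZdH_opsAllZd_cube_apply` (the unfolded reading: `α₀ ≤ aI`, `U₀ ∈ 𝔄_m(α₀)` unitary, Hermitian
  `A ∈ E(□₀)`, `J = Δ_a(U₀)A` on the bonds of `□₀` ⟹ `G_𝔤(U₀)J = A`).
* §3 ★★★ `sockB9P3D4γ_withGopZdH_opsAllZd_cube` — `∃ aI > 0`, `SockB9P3D4β L B₀′ B_∂ cP i.η m i.Ω i.Λs (cubeLamBP …)` with `B₀′ = max{1, 2B₀max{1,q}}`,
  `B_∂ = (20d+2)B₀′`, `q = qQ d L Cτ β_τ 1`, `cP = min{1∕16, c₆∕M, a₀∕(K₆M), a₃∕(K₆M), aI, 1∕(2B₀·14(d−1)·M+1)}`, from `hdict`, `hP6`, `h33U` alone.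

HONEST SCOPE ∕ A6.  By-name composition; `aI` EXISTENTIAL and MEMBER-DEPENDENT (compactness∕continuity — print's uniform `α₀′, M₀` of Thm 3.11 rest on
Thm 3.3 and (3.115), not proved), so the FAMILY binder `∀ M j m, InvAtHI … aI M (ι j) m` with one `aI` is witnessed here only member by member (uniformly
on finite index families by `min`); the displayed `hdict`∕`hP6`∕`h33U` are NOT discharged (Thm 3.3 = N06's node content; `Prop6At` = dag-n05-e's); `a₃`
now only feeds `LandauAt`'s idle guard; no bound on `G_𝔤`; count-neutral helper of K1⁷ (`--supports stmt-QuantumFields-20542`); N05∕N06 NOT discharged;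
one finite `𝕋⁴` programme at fixed `ε`, Bałaban as printed; R4 closes only the conditional finite-`𝕋⁴` rung `BalabanLadder.UV` — nothing continuum ∕ `ℝ⁴`
∕ OS ∕ mass gap ∕ Clay.  Unit `pub-ymgap-dag-n06-b` (g20), 2026-08-28.
-/

noncomputable section

open scoped BigOperators
open NormedSpace

namespace Literature.MathematicalPhysics.QuantumFieldTheory.Balaban1983to89.B9Thm311InvAtHIWitnessCubeZd

open B7Prop1Explicit (e gaugeAct)
open B7Prop1Local (InBox)
open B7Prop2Explicit (unitaryUnits unitaryUnits_le_U1)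
open B8Ineq132 (PlaqTouches BondTouches plaqF InAk)
open B8Eq131Cubes (cube sqLo sqHi cube_anti)
open B8Eq131CubesAdmissible (cubeFam cubeFam_false_of_le cubeFam_false_zero)
open B8CubeMemberZd (cubeLamS)
open B8Ineq159FlatCubeMemberPrinted (cubeLamBP)
open B8LeafModelZd (ZdIdx)
open B9SupplySockB9P3ZdLetters (OpsZd deltaAOf)
open B9SupplySockB9P3ZdLettersOmega (OnDom Margin2 margin2_cubeFam)
open B9SupplySockB9P3ZdAt (DictAt Prop6At LandauAt)
open B9SupplySockB9P3ZdBeta (SockB9P3D4β)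
open B9SupplySockB9P3ZdGamma (SeesDom AvgAtγ seesDom_cubeLamBP)
open B9SupplySockB9P3ZdGammaInAk (CurvAtInAk)
open B9Eq327GreenZd (domSub bondPair)
open B9Eq327GreenZdHerm (domSubH RegularAtH gopZdH withGopZdH withGopZdH_Gop deltaAOf_withGopZdH gopZdH_apply_eq_of_regularAtH)
open B9SupplySockB9P3ZdAllLettersZd (opsAllZd curvAtInAk_opsAllZd landauAt_opsAllZd)
open B9Eq316AveragingTransposeZd (Reg17 alphaQ qQ betaTau)
open B9Eq316AveragingTransposeZdLevelZero (avgAtγ_opsAllZd_cubeLamBP)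
open B9SupplySockB9P3ZdAtHermInAk (InvAtHI invAtHI_of_forall sockB9P3D4γIHI_at)
open B9Thm311PerMemberCubeZdTouching (gopZdH_deltaAOf_of_inAk_cube regularAtH_of_inAk_cube)

export B7Prop1Explicit (Site)

variable {d : ℕ} {𝔸 : Type*} [CStarAlgebra 𝔸]

/-! ## §1 The co-letter binders do not read `Gop` -/

section Transfer

variable {L : ℕ} (ops : ℝ → ZdIdx d L → ℕ → OpsZd d 𝔸) (M : ℝ) (i : ZdIdx d L) (m : ℕ)

/-- `CurvAtInAk` reads `Dp` only: unchanged under `withGopZdH`. [cite: Balaban1985BackgroundPropagators, (3.69) p.404, (3.27) p.395 (bookkeeping)] -/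
theorem curvAtInAk_withGopZdH_iff (c69 : ℝ) : CurvAtInAk L (withGopZdH ops) c69 M i m ↔ CurvAtInAk L ops c69 M i m := Iff.rfl

/-- `AvgAtγ` reads `QQ` only: unchanged under `withGopZdH`. [cite: Balaban1985BackgroundPropagators, (3.16) p.393, (3.27) p.395 (bookkeeping)] -/
theorem avgAtγ_withGopZdH_iff (q : ℝ) (ΛbP : ℕ → ℕ → Set (Site d × Fin d)) :
    AvgAtγ L (withGopZdH ops) q ΛbP M i m ↔ AvgAtγ L ops q ΛbP M i m := Iff.rfl

variable {I : Type} (bg : I → B9.Backgrounds) (mem : ℝ → ZdIdx d L → ℕ → I)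
variable (ιCfg : ∀ (M : ℝ) (i : ZdIdx d L) (m : ℕ) (U₀ : Site d → Fin d → 𝔸ˣ),
  (∀ x κ, U₀ x κ ∈ unitaryUnits 𝔸) → (bg (mem M i m)).Cfg)

/-- `LandauAt` reads `DRDs` only: unchanged under `withGopZdH`. [cite: Balaban1985BackgroundPropagators, (3.20)–(3.21) p.394, (3.27) p.395 (bookkeeping)] -/
theorem landauAt_withGopZdH_iff (c35 a₃ : ℝ) :
    LandauAt bg L mem ιCfg (withGopZdH ops) c35 a₃ M i m ↔ LandauAt bg L mem ιCfg ops c35 a₃ M i m := Iff.rfl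

end Transfer

/-! ## §2 The (3.27) binder in the datum's currency, inhabited by the genuine `G_𝔤` at every cube member -/

section Witness

variable [Nontrivial 𝔸] (τ : 𝔸 →ₗ[ℂ] ℂ) [FiniteDimensional ℝ 𝔸] {L : ℕ}
  (hτp : ∀ a : 𝔸, a ≠ 0 → 0 < (τ (star a * a)).re) (hτt : ∀ a b : 𝔸, τ (a * b) = τ (b * a))
  (hτs : ∀ a : 𝔸, τ (star a) = starRingEnd ℂ (τ a))

include hτp hτt hτs in
/-- ★★★ **THE JUNCTION'S (3.27) BINDER IS INHABITED AT EVERY CUBE MEMBER, EVERY TRUNCATION `m ≤ k`, BY THE GENUINE `G_𝔤(U₀)`.**  At a cube member of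
[Balaban1985RegularSpaces] (1.131) (`Ω = cubeFam false L a Mc ρ k`, `Λs = cubeLamS …`, `m ≤ k`, `2 ≤ d`, `2 ≤ L ≤ ρ`), print's class `cubeLamBP`, faithful
Hermitian tracial `τ` on a finite-dimensional fibre, ANY base record `ops₀` and block parameter `M`: there is `aI > 0` (member-dependent) such that
`InvAtHI L (withGopZdH (opsAllZd τ L (cubeLamBP …) ops₀)) aI M i m` — i.e. for every `α₀ ≤ aI`, every unitary `U₀ ∈ 𝔄_m({□_j}, α₀)`, every Hermitian
`A ∈ E(□₀)` and every `J` agreeing with the genuine `Δ_a(U₀)A` on the bonds of `□₀`: `G_𝔤(U₀)J = A` with `G_𝔤(U₀) = (□₀Δ_a(U₀)□₀)⁻¹` (`gopZdH`).  The first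
`m ≥ 1` witness of the (3.27) slot of this lineage's member suppliers. [cite: Balaban1985BackgroundPropagators, (3.27) p.395, Thm 3.11 p.416; Balaban1985RegularSpaces, (1.58) p.86, (1.33) p.82, (1.7) p.77, (1.131) p.99] -/
theorem invAtHI_withGopZdH_opsAllZd_cube (hd2 : 2 ≤ d) (hL : 2 ≤ L) (ops₀ : ℝ → ZdIdx d L → ℕ → OpsZd d 𝔸) (M : ℝ) (i : ZdIdx d L)
    {a : Site d} {Mc ρ : ℕ} (hρ : L ≤ ρ) (hΩ : i.Ω = cubeFam false L a Mc ρ i.k) (hΛs : i.Λs = cubeLamS L a Mc ρ i.k) {m : ℕ} (hm : m ≤ i.k) :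
    ∃ aI : ℝ, 0 < aI ∧ InvAtHI L (withGopZdH (opsAllZd τ L (cubeLamBP L a Mc ρ i.k) ops₀)) aI M i m := by
  obtain ⟨α, hα, h⟩ := gopZdH_deltaAOf_of_inAk_cube τ hτp hτt hτs hd2 hL ops₀ M i hρ hΩ hΛs hm
  refine ⟨α, hα, invAtHI_of_forall L fun α₀ hα₀ U₀ hU₀ hIn A hA J hJ => ?_⟩
  rw [withGopZdH_Gop]
  exact h α₀ hα₀ U₀ hU₀ hIn A hA J fun y μ hb => by rw [hJ y μ hb, deltaAOf_withGopZdH]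

include hτp hτt hτs in
/-- ★★ **THE UNFOLDED READING** — (3.27) as (1.58) uses it, at every datum of the junction near the member: `α₀ ≤ aI`, `U₀ ∈ 𝔄_m({□_j}, α₀)` unitary, Hermitian
`A ∈ E(□₀)` (`OnDom`), `J = Δ_a(U₀)A` on the bonds of `□₀` ⟹ `G_𝔤(U₀)J = A`, and `RegularAtH` there. [cite: Balaban1985BackgroundPropagators, (3.27) p.395, Thm 3.11 p.416; Balaban1985RegularSpaces, (1.58) p.86] -/
theorem invAtHI_withGopZdH_opsAllZd_cube_apply (hd2 : 2 ≤ d) (hL : 2 ≤ L) (ops₀ : ℝ → ZdIdx d L → ℕ → OpsZd d 𝔸) (M : ℝ) (i : ZdIdx d L)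
    {a : Site d} {Mc ρ : ℕ} (hρ : L ≤ ρ) (hΩ : i.Ω = cubeFam false L a Mc ρ i.k) (hΛs : i.Λs = cubeLamS L a Mc ρ i.k) {m : ℕ} (hm : m ≤ i.k) :
    ∃ aI : ℝ, 0 < aI ∧ ∀ α₀ : ℝ, α₀ ≤ aI → ∀ U₀ : Site d → Fin d → 𝔸ˣ, (∀ x κ, U₀ x κ ∈ unitaryUnits 𝔸) → InAk L m i.η α₀ i.Ω U₀ →
      RegularAtH i.η (opsAllZd τ L (cubeLamBP L a Mc ρ i.k) ops₀ M i m) (i.Ω 0) U₀ ∧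
        ∀ A : Site d → Fin d → 𝔸, OnDom L m i.η i.Ω A → (∀ (y : Site d) (τ' : Fin d), IsSelfAdjoint (A y τ')) →
          ∀ J : Site d → Fin d → 𝔸,
            (∀ (y : Site d) (μ : Fin d), BondTouches (i.Ω 0) y μ → J y μ = deltaAOf i.η (opsAllZd τ L (cubeLamBP L a Mc ρ i.k) ops₀ M i m) U₀ A y μ) →
            gopZdH i.η (opsAllZd τ L (cubeLamBP L a Mc ρ i.k) ops₀ M i m) (i.Ω 0) U₀ J = A := by
  obtain ⟨α, hα, h⟩ := regularAtH_of_inAk_cube τ hτp hτt hτs hd2 hL ops₀ M i hρ hΩ hΛs hm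
  refine ⟨α, hα, fun α₀ hα₀ U₀ hU₀ hIn => ⟨(h α₀ hα₀ U₀ hU₀ hIn).1, fun A hA hsa J hJ => ?_⟩⟩
  exact gopZdH_apply_eq_of_regularAtH i.η _ (i.Ω 0) U₀ (h α₀ hα₀ U₀ hU₀ hIn).1 (B9Eq327GreenZdHerm.mem_domSubH_of_onDom hA hsa) hJ

omit [Nontrivial 𝔸] [FiniteDimensional ℝ 𝔸] in
/-- **A6 — THE BINDER'S HYPOTHESIS SET IS MET**: for every `α₀ > 0` the flat background `U₀ = 1` is a unitary datum of `𝔄_m({Ω_j}, α₀)` at every member, so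
`InvAtHI … aI M i m` with `aI > 0` speaks about an inhabited class (and, by `B9Thm311PerMemberCubeZdTouching`, about every unitary datum near it).
[cite: Balaban1985RegularSpaces, (1.7) p.77, (1.33) p.82] -/
theorem exists_datum_inAk (hL : 1 ≤ L) (i : ZdIdx d L) (m : ℕ) {α₀ : ℝ} (hα₀ : 0 < α₀) :
    ∃ U₀ : Site d → Fin d → 𝔸ˣ, (∀ x κ, U₀ x κ ∈ unitaryUnits 𝔸) ∧ InAk L m i.η α₀ i.Ω U₀ :=
  ⟨1, fun _ _ => (unitaryUnits 𝔸).one_mem, B8Prop6OfThm4.one_inAk hL m i.hη hα₀ i.Ω⟩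

end Witness

/-! ## §3 The β collar socket at a cube member for the genuine record, from the dictionary, Prop. 6 and Theorem 3.3 alone -/

section Socket

variable [Nontrivial 𝔸]
variable {I : Type} (geo : I → B9.Geometry) (bg : I → B9.Backgrounds) (GA : ∀ i, B9.KernelFamily (geo i) (bg i))
variable (L : ℕ) (mem : ℝ → ZdIdx d L → ℕ → I)
variable (ιCfg : ∀ (M : ℝ) (i : ZdIdx d L) (m : ℕ) (U₀ : Site d → Fin d → 𝔸ˣ),
  (∀ x κ, U₀ x κ ∈ unitaryUnits 𝔸) → (bg (mem M i m)).Cfg)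
variable (ιLoc : ∀ (M : ℝ) (i : ZdIdx d L) (m : ℕ), (Site d → Fin d → 𝔸) → (geo (mem M i m)).Loc)
variable (τ : 𝔸 →ₗ[ℂ] ℂ) [FiniteDimensional ℝ 𝔸]
  (hτp : ∀ a : 𝔸, a ≠ 0 → 0 < (τ (star a * a)).re) (hτt : ∀ a b : 𝔸, τ (a * b) = τ (b * a))
  (hτs : ∀ a : 𝔸, τ (star a) = starRingEnd ℂ (τ a))

include hτp hτt hτs in
/-- ★★★ **THE β COLLAR SOCKET AT A CUBE MEMBER FOR THE GENUINE RECORD, WITH THE (3.27), Δ′, LANDAU AND AVERAGING BINDERS DISCHARGED.**  At a cube member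
(`Ω = cubeFam false L a Mc ρ k`, `Λs = cubeLamS …`, `m ≤ k`, `2 ≤ d`, `2 ≤ L ≤ ρ`), for the record `withGopZdH (opsAllZd τ L (cubeLamBP …) ops₀)` (genuine
`G_𝔤`, `Δ′`, `D R 𝟙 D*`, `Q*aQ` at print's class), a faithful Hermitian tracial `τ` with `|Re τ(x*y)| ≤ C_τ‖x‖‖y‖`, block parameter `M ≥ 1`: GIVEN the
dictionary `DictAt` of the record into Thm 3.3's frame, Prop. 6 `Prop6At` at the frame, and Thm 3.3's (3.42)∕(3.47) block `h33U` for `G_𝔤(U₀)` at the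
frame's class — and NOTHING ELSE —, there is `aI > 0` (the (3.27) threshold of §2) with the four-line collar socket
`SockB9P3D4β L B₀′ ((20d+2)B₀′) cP i.η m i.Ω i.Λs (cubeLamBP …)`, `B₀′ = max{1, 2B₀max{1,q}}`, `q = qQ d L C_τ β_τ 1`,
`cP = min{1∕16, c₆∕M, a₀∕(K₆M), a₃∕(K₆M), aI, 1∕(2B₀·14(d−1)·M+1)}` — the member supplier `sockB9P3D4γIHI_at` run with `hinv` :=
`invAtHI_withGopZdH_opsAllZd_cube`, `hcurv` := `curvAtInAk_opsAllZd`, `hlan` := `landauAt_opsAllZd`, `havg` := `avgAtγ_opsAllZd_cubeLamBP` (EDITION P₀),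
`hsee` := `seesDom_cubeLamBP`, `Margin2` := `margin2_cubeFam`. [cite: Balaban1985RegularSpaces, (1.58)–(1.59) p.86, Prop. 3 p.87, (1.131) p.99, p.77; Balaban1985BackgroundPropagators, Thm 3.3 p.399, (3.26)–(3.27) p.395, Thm 3.11 p.416, (3.47) p.398, (3.69) p.404, (3.16) p.393; Balaban1984PropagatorsII, (2.3) p.224] -/
theorem sockB9P3D4γ_withGopZdH_opsAllZd_cube [NeZero L] (hd2 : 2 ≤ d) (hL : 2 ≤ L)
    {Cτ : ℝ} (hCτ : ∀ x y : 𝔸, |(τ (star x * y)).re| ≤ Cτ * ‖x‖ * ‖y‖)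
    (ops₀ : ℝ → ZdIdx d L → ℕ → OpsZd d 𝔸) {c35 c₆ K₆ a₃ : ℝ} {M : ℝ} (hM1 : 1 ≤ M) (i : ZdIdx d L)
    {a : Site d} {Mc ρ : ℕ} (hρ : L ≤ ρ) (hΩ : i.Ω = cubeFam false L a Mc ρ i.k) (hΛs : i.Λs = cubeLamS L a Mc ρ i.k) {m : ℕ} (hm : m ≤ i.k)
    (hdict : DictAt geo bg GA L mem ιCfg ιLoc (withGopZdH (opsAllZd τ L (cubeLamBP L a Mc ρ i.k) ops₀)) M i m)
    (hP6 : Prop6At bg L mem ιCfg c35 c₆ K₆ M i m)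
    (hK₆ : 0 < K₆) {B₀ δ₀ a₀ : ℝ} (hB₀ : 0 < B₀)
    (h33U : ∀ (α₀ : ℝ) (U₀ : Site d → Fin d → 𝔸ˣ) (hU₀ : ∀ x κ, U₀ x κ ∈ unitaryUnits 𝔸), 0 < α₀ → M * α₀ ≤ a₀ →
      (bg (mem M i m)).Reg335 c35 α₀ (ιCfg M i m U₀ hU₀) →
      B9.Ineq342_346_347 (GA (mem M i m)) B₀ δ₀ (ιCfg M i m U₀ hU₀)) :
    ∃ aI : ℝ, 0 < aI ∧
      SockB9P3D4β (𝔸 := 𝔸) L (max 1 (2 * B₀ * max 1 (qQ d L Cτ (betaTau τ) 1)))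
        ((20 * d + 2) * max 1 (2 * B₀ * max 1 (qQ d L Cτ (betaTau τ) 1)))
        (min (1 / 16) (min (c₆ / M) (min (a₀ / (K₆ * M)) (min (a₃ / (K₆ * M)) (min aI (1 / (2 * B₀ * (14 * ((d - 1 : ℕ) : ℝ)) * M + 1)))))))
        i.η m i.Ω i.Λs (cubeLamBP L a Mc ρ i.k) := by
  have hL1 : 1 ≤ L := le_trans (by norm_num) hL
  have hfin : (i.Ω 0).Finite := B9Thm311PosDefOpenZd.cubeMember_Ω0_finite i hΩ
  have hMi : Margin2 i.Ω := by rw [hΩ]; exact margin2_cubeFam L a Mc (le_trans hL hρ) i.k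
  have hsee : SeesDom L m (i.Ω 0) (cubeLamBP L a Mc ρ i.k) := by rw [hΩ]; exact seesDom_cubeLamBP hL1 a Mc hρ hm
  have hq : 0 ≤ qQ d L Cτ (betaTau τ) 1 := by
    have hCτ0 : 0 ≤ Cτ := by
      have h := hCτ 1 1
      rw [star_one, one_mul, norm_one, mul_one, mul_one] at h
      exact le_trans (abs_nonneg _) h
    have hβ : 0 ≤ betaTau τ := by
      unfold betaTau
      split_ifs
      · exact Finset.sum_nonneg fun i _ => mul_nonneg (norm_nonneg _) (norm_nonneg _)
      · exact le_rfl
    have hα : 0 ≤ alphaQ d L := (B9Eq316AveragingTransposeZd.alphaQ_pos d hL1).le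
    have hθ : 0 ≤ B7Prop5GeneralLevels.thetaGen d L (alphaQ d L) := by
      unfold B7Prop5GeneralLevels.thetaGen; positivity
    unfold qQ; positivity
  obtain ⟨aI, haI, hinv⟩ := invAtHI_withGopZdH_opsAllZd_cube τ hτp hτt hτs hd2 hL ops₀ M i hρ hΩ hΛs hm
  refine ⟨aI, haI, ?_⟩
  exact sockB9P3D4γIHI_at (geo := geo) (bg := bg) (GA := GA) (L := L) (mem := mem) (ιCfg := ιCfg) (ιLoc := ιLoc)
    (ops := withGopZdH (opsAllZd τ L (cubeLamBP L a Mc ρ i.k) ops₀))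
    hd2 hL1 hM1 i hMi hdict hP6 hinv
    ((curvAtInAk_withGopZdH_iff _ M i m _).mpr (curvAtInAk_opsAllZd τ L (cubeLamBP L a Mc ρ i.k) ops₀ hL1 hM1 i m))
    ((landauAt_withGopZdH_iff _ M i m bg mem ιCfg c35 a₃).mpr
      (landauAt_opsAllZd τ L (cubeLamBP L a Mc ρ i.k) ops₀ M i m bg mem ιCfg hτt hτs hτp c35 a₃ hfin))
    (cubeLamBP L a Mc ρ i.k)
    ((avgAtγ_withGopZdH_iff _ M i m _ _).mpr (avgAtγ_opsAllZd_cubeLamBP τ hd2 hL hCτ ops₀ M i hρ hΩ hm))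
    hsee hK₆ (by positivity) hq hB₀ h33U

end Socket

end Literature.MathematicalPhysics.QuantumFieldTheory.Balaban1983to89.B9Thm311InvAtHIWitnessCubeZd

end
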